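import Mathlib.GroupTheory.QuotientGroup.Basic
import Mathlib.GroupTheory.GroupAction.Quotient
import Mathlib.Data.Set.Card

/-!
# Double cosets of a product subgroup `K₁ × K₂` in a product group `G₁ × G₂`

Kernel annex of the Tier-5 record (blind lane).  The Hecke files of this seat take as hypothesis
«every `K g K / K` is finite» (`hK : ∀ g, Finite (MulAction.orbit K (g : G ⧸ K))`).  The record
applies the dictionary to the dual pair `G × H` with `K = K_G × K_H`; this file records that the
hypothesis (and the degrees `#(KgK/K)`) pass from the factors to the product, through Mathlib's
`QuotientGroup.prodEquiv : (G × H) ⧸ (A.prod B) ≃ (G ⧸ A) × (H ⧸ B)`: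

* `prodEquiv_smul` — the bijection is equivariant for the componentwise actions;
* `mem_orbit_prod_iff` — `(g', h')K ∈ K (g, h) K / K` iff `g'A ∈ A g A / A` and `h'B ∈ B h B / B`;
* `prodEquiv_image_orbit` — the `K₁ × K₂`-orbit of `(x₁, x₂)` is the product of the orbits;
* `finite_orbit_prod` — finite double cosets in the factors ⇒ finite double cosets in the product;
* `ncard_orbit_prod` — `#(K (g,h) K / K) = #(A g A / A) · #(B h B / B)` (the degree of `T_{(g,h)}` is
  the product of the degrees).

What stays prose: the printed theorems; which product `U(V_v) × U(W_v)` and which `K` the record means.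
-/

namespace Summit.Ventures.HodgeRepro2.T5HeckeProductDoubleCosets

variable {G : Type*} [Group G] {H : Type*} [Group H] (A : Subgroup G) (B : Subgroup H)

/-- `prodEquiv` on a coset of a pair. -/
theorem prodEquiv_mk (g : G) (h : H) :
    QuotientGroup.prodEquiv A B ((g, h) : G × H) = ((g : G ⧸ A), (h : H ⧸ B)) := rfl

/-- `prodEquiv` is equivariant for the componentwise left actions. -/
theorem prodEquiv_smul (p : G × H) (x : (G × H) ⧸ A.prod B) :
    QuotientGroup.prodEquiv A B (p • x) =
      (p.1 • (QuotientGroup.prodEquiv A B x).1, p.2 • (QuotientGroup.prodEquiv A B x).2) := by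
  induction x using QuotientGroup.induction_on with
  | H x =>
    obtain ⟨g, h⟩ := x
    obtain ⟨a, b⟩ := p
    rfl

/-- The `A.prod B`-orbit of `(g, h)` in `(G × H) ⧸ A.prod B` is read off componentwise:
`(g', h') ∈ K (g, h) K / K` iff `g' A ∈ A g A / A` and `h' B ∈ B h B / B`. -/
theorem mem_orbit_prod_iff (g g' : G) (h h' : H) :
    (((g', h') : G × H) : (G × H) ⧸ A.prod B) ∈
        MulAction.orbit (A.prod B) (((g, h) : G × H) : (G × H) ⧸ A.prod B) ↔
      ((g' : G) : G ⧸ A) ∈ MulAction.orbit A ((g : G) : G ⧸ A) ∧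
        ((h' : H) : H ⧸ B) ∈ MulAction.orbit B ((h : H) : H ⧸ B) := by
  constructor
  · rintro ⟨⟨⟨a, b⟩, hab⟩, hx⟩
    rw [Subgroup.mem_prod] at hab
    have hx' : ((a, b) : G × H) • (((g, h) : G × H) : (G × H) ⧸ A.prod B) =
        (((g', h') : G × H) : (G × H) ⧸ A.prod B) := hx
    have := congrArg (QuotientGroup.prodEquiv A B) hx'
    rw [prodEquiv_smul, prodEquiv_mk, prodEquiv_mk] at this
    simp only [Prod.mk.injEq] at this
    exact ⟨⟨⟨a, hab.1⟩, this.1⟩, ⟨⟨b, hab.2⟩, this.2⟩⟩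
  · rintro ⟨⟨⟨a, ha⟩, hx⟩, ⟨⟨b, hb⟩, hy⟩⟩
    refine ⟨⟨(a, b), Subgroup.mem_prod.2 ⟨ha, hb⟩⟩, ?_⟩
    change ((a, b) : G × H) • (((g, h) : G × H) : (G × H) ⧸ A.prod B) =
      (((g', h') : G × H) : (G × H) ⧸ A.prod B)
    apply (QuotientGroup.prodEquiv A B).injective
    rw [prodEquiv_smul, prodEquiv_mk, prodEquiv_mk]
    exact Prod.ext hx hy

/-- The image under `prodEquiv` of the `A.prod B`-orbit of `x` is the product of the orbits of the
two components of `prodEquiv x`. -/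
theorem prodEquiv_image_orbit (x : (G × H) ⧸ A.prod B) :
    QuotientGroup.prodEquiv A B '' MulAction.orbit (A.prod B) x =
      MulAction.orbit A (QuotientGroup.prodEquiv A B x).1 ×ˢ
        MulAction.orbit B (QuotientGroup.prodEquiv A B x).2 := by
  induction x using QuotientGroup.induction_on with
  | H x =>
    obtain ⟨g, h⟩ := x
    ext y
    obtain ⟨y₁, y₂⟩ := y
    induction y₁ using QuotientGroup.induction_on with
    | H g' =>
      induction y₂ using QuotientGroup.induction_on with
      | H h' =>
        rw [prodEquiv_mk, Set.mem_prod]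
        constructor
        · rintro ⟨z, hz, hzy⟩
          have : z = (((g', h') : G × H) : (G × H) ⧸ A.prod B) := by
            apply (QuotientGroup.prodEquiv A B).injective
            rw [hzy, prodEquiv_mk]
          rw [this] at hz
          exact (mem_orbit_prod_iff A B g g' h h').1 hz
        · intro hy
          exact ⟨(((g', h') : G × H) : (G × H) ⧸ A.prod B),
            (mem_orbit_prod_iff A B g g' h h').2 hy, prodEquiv_mk A B g' h'⟩

/-- Finite double cosets in both factors give finite double cosets in the product. -/
theorem finite_orbit_prod (g : G) (h : H) [Finite (MulAction.orbit A ((g : G) : G ⧸ A))]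
    [Finite (MulAction.orbit B ((h : H) : H ⧸ B))] :
    Finite (MulAction.orbit (A.prod B) (((g, h) : G × H) : (G × H) ⧸ A.prod B)) := by
  have himg := prodEquiv_image_orbit A B (((g, h) : G × H) : (G × H) ⧸ A.prod B)
  rw [prodEquiv_mk] at himg
  have hfin : (MulAction.orbit (A.prod B) (((g, h) : G × H) : (G × H) ⧸ A.prod B)).Finite := by
    rw [← Set.finite_image_iff (QuotientGroup.prodEquiv A B).injective.injOn, himg]
    exact Set.Finite.prod (Set.toFinite _) (Set.toFinite _)
  exact hfin.to_subtype

/-- The hypothesis «every `K g K / K` is finite» passes to the product `K₁ × K₂`. -/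
theorem forall_finite_orbit_prod (hA : ∀ g : G, Finite (MulAction.orbit A (g : G ⧸ A)))
    (hB : ∀ h : H, Finite (MulAction.orbit B (h : H ⧸ B))) (p : G × H) :
    Finite (MulAction.orbit (A.prod B) (p : (G × H) ⧸ A.prod B)) := by
  obtain ⟨g, h⟩ := p
  haveI := hA g
  haveI := hB h
  exact finite_orbit_prod A B g h

/-- The degree of a double coset of the product is the product of the degrees:
`#(K (g, h) K / K) = #(A g A / A) · #(B h B / B)`. -/
theorem ncard_orbit_prod (g : G) (h : H) :
    (MulAction.orbit (A.prod B) (((g, h) : G × H) : (G × H) ⧸ A.prod B)).ncard =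
      (MulAction.orbit A ((g : G) : G ⧸ A)).ncard * (MulAction.orbit B ((h : H) : H ⧸ B)).ncard := by
  have himg := prodEquiv_image_orbit A B (((g, h) : G × H) : (G × H) ⧸ A.prod B)
  rw [prodEquiv_mk] at himg
  rw [← Set.ncard_image_of_injective _ (QuotientGroup.prodEquiv A B).injective, himg,
    Set.ncard_prod]

end Summit.Ventures.HodgeRepro2.T5HeckeProductDoubleCosets
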